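import Summits.HodgeConjecture.Statement
import Summits.HodgeConjecture.HodgeConjecture.Theorems.WeilTypeLadderOnPath
import Summits.HodgeConjecture.HodgeConjecture.Theorems.SevenfoldWeilCensusAssembly
import HarnessLib

/-!
# WeilTypeLadderSixfoldsConcordance — "HC for ALL complex abelian sixfolds" against the Weil-type ladder

b2b cell `hweil` (packet `run/shared/lean/b2b/hodge-weil/`, LADDER.md `## CARVER` v2.1, R6 concordance:
"HC for all abelian sixfolds = which rungs exactly"). Everything in this file is PROVED (no `sorry`, no new
axioms, no new definitions): the node

  R6 := `∀ A : AbelianVariety ℂ, A.dim = 6 → IsSmoothProjective A.dim A.X → HodgeConjectureFor A.dim A.X`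

(the Hodge conjecture for EVERY complex abelian sixfold — all Hodge classes, not only Weil classes, all
endomorphism types) and its envelope R7 (`A.dim ≤ 7`, verbatim the conclusion of the assembly item
`Theses.SevenfoldWeilCensus.Assembly`, stmt-HodgeConjecture-18724) are written INLINE as hypothesis /
conclusion types (named `@[conjecture]` leaves `WeilTypeLadder.AbelianSixfolds` / `AbelianDimLeSeven` are
staged in the packet for a prover seat; Theorems leaves are prover-only, D-0016).

ARROWS (kernel-checked here):
* on-path `hodgeConjectureFor_sixfolds_of_hodgeConjecture`, `hodgeConjectureFor_dim_le_seven_of_hodgeConjecture`;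
* DOWN `weilSixfolds_of_hodgeConjectureFor_sixfolds` : R6 → R1 (`Theses.SevenfoldWeilCensus.WeilSixfolds`,
  stmt-HodgeConjecture-2524: a Weil class of `(A, φ² = -d)`, `dim A = 6`, is a rational `(3,3)`-class on a
  smooth projective sixfold) and `nonsplitSixfolds_of_hodgeConjectureFor_sixfolds` : R6 → R1′;
* UP `hodgeConjectureFor_dim_le_seven_of_census` = the SEVENFOLD REDUCTION of route `SevenfoldWeilCensus` BY NAME
  (`Theorems.sevenfoldWeilCensus_assembly_proof`, proved @ 674f8bd141e6) at its unfolded type, and its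
  restriction `hodgeConjectureFor_sixfolds_of_census`:
  `CodimTwoFromLowerDim (stmt-18721) → CodimThreeWeilGeneration (stmt-18720) → WeilSixfolds (R1) →
   HodgeAbelianDimLeFive (F3) → R7 → R6`.

SO, MODULO KERNEL-CHECKED GLUE: R6 ⟸ R1 ∧ X2|₆ ∧ X1|₆ ∧ F3 and R6 ⟹ R1, where X2/X1 are the two CENSUS cruxes
of route `SevenfoldWeilCensus` (OPEN, Hodge-theoretic generation statements two dimensions past Moonen–Zarhin,
NOT cases of the Hodge conjecture) and F3 is the dim `≤ 5` floor, the cite-only named fact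
`Markman2025_hodgeClasses_algebraic_abelian_dim_le_five` (Markman, arXiv:2502.03415 Cor. 1.3 — an UNREFEREED
preprint — with Moonen–Zarhin, Math. Ann. 315 (1999) = arXiv:math/9901113; every use is conditional on
[Markman 2025, Cor. 1.3]). "HC for all abelian sixfolds" is therefore NOT a rung of Markman's Weil-type ladder
and is not known to reduce to Weil-class rungs of dimension 6 alone. Stratum by stratum (sources; nothing below
is asserted in Lean):
* simple, types I and II — `End⁰ = ℚ` (Serre; Pink 1998 Thm 5.14: `g = 6 ∉ 𝒮 = {2^{k-1}aᵏ} ∪ {½·C(2k,k)}`, so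
  `MT = GSp₁₂`), I(2), I(3), I(6), II(1), II(3) (Banaszak–Gajda–Krasoń 2006, odd relative dimension or 2): Hodge
  group = Lefschetz group and `B•(Aⁿ) = D•(Aⁿ)` (Murty 1984 / Hazama) — nothing needed
  [corpus: arXiv:1602.08354 (Cantoral-Farfán survey) p. 9 Thm 5.3–5.6, p. 10 Thm 5.8 + Rem. 5.9; doi:10.4171/dms/4/2].
* simple, type III(1) (`D` definite quaternion over `ℚ`, `D`-rank 3): exceptional classes exist (Murty, Math.
  Ann. 268 (1984)); `Hg = SO_D` (the 6-dimensional `W` in `V ⊗ ℂ = ℂ² ⊗ W` is absolutely irreducible), the extra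
  invariants `Sym⁶(ℂ²) ⊗ det W ⊂ H⁶` are spanned by the Weil classes `W_k`, `k ⊂ D` imaginary quadratic acting
  `(3,3)` (sixfold analogue of Moonen–Zarhin, Duke 77 (1995) 7.2 / van Geemen 1994 §4.13) — inside R1, whose
  binder is ANY sixfold with `φ² = -d` [corpus: book:green1994… p. 219 §4.13; planner computation, LADDER C4].
* simple, type IV: `k` imaginary quadratic acting `(3,3)` → R1; `(4,2)`, `(5,1)` → `Hg = U(V, φ)` expected,
  `B = D` (Ribet 1983 for coprime multiplicities; the `(2,4)` case is a named risk of X2); CM fields of degree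
  4 / 6 → divisors or a `(3,3)` subfield `k` (R1); CM TYPE (degree 12): by André 1992 (Milne's endnote M.12 to
  Deligne 1982) every Hodge class of codimension `r` on `A` is a sum of `f_J^*` of WEIL CLASSES w.r.t. the
  degree-12 CM field `E` on `A_J = A^{2r}` (dimension 24 for `r = 2`, 36 for `r = 3`) — instances of rung R3
  (`WeilTypeLadder.WeilClassesCMField`, `e = 12`, `m = r`), or of R1 when the class is `W_k` of a `(3,3)` subfield;
  direct CM results: Shioda / Aoki 2002 (Fermat factors; tree: `FermatJacobianPowersHodgeConjecture`,
  `HeckePrymWeilWeilSixfoldsSqrtMinus7FermatTypeFortyTwo`) [corpus: doi:10.1007/978-3-540-38955-2_3 p. 64 M.12].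
* non-simple: Hodge groups of products (Hazama 1985 = MZ99 (3.2); Moonen–Zarhin 1999 §3; Lombardo 2016
  arXiv:1402.1478 Thm 1/4, dim ≤ 5 only): exceptional classes are pull-backs from factors / quotients (F1
  fourfolds, F3) or Weil classes of the product itself for an imaginary quadratic `k` of total multiplicity
  `(3,3)` (MZ99 cases (a), (e), (f) one dimension up: `E_k × X₅`, `X₂ × X₄`, `X₃ × X₃′`, …) — again inside R1.
  No Hodge-group census of complex abelian SIXFOLDS exists in print [no hits for "abelian sixfold | abelian
  varieties of dimension 6" in galaxy (panama+pdf+crabby) nor for "Hodge group simple abelian variety dimension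
  six exceptional" in corpus fts+vec beyond MZ99 / vG94 / Deligne–Milne]; that census IS cruxes X1/X2.
CHEAPEST FALSIFIER of the reduction (for refuters of stmt-18721): a SIMPLE CM sixfold has no lower-dimensional
quotient, so X2 demands `B²(A) = D²(A)` there; by Pohlmann's criterion this is a finite check over degree-12 CM
Galois types `(G, ρ, Φ)`: a 4-set `S` of embeddings with `|S ∩ gΦ| = 2` for all `g ∈ G` that is not a union of
two conjugate pairs refutes X2 (Dodson, Trans. AMS 283 (1984) for the degenerate types).
-/

-- every declaration of this problem lives in `Summit.HodgeConjecture.HodgeConjecture.…` (summit = sub-problem)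
set_option linter.dupNamespace false

noncomputable section

open CategoryTheory

namespace Summit.HodgeConjecture.HodgeConjecture.WeilTypeLadder

open Literature.AlgebraicGeometry Literature.AlgebraicGeometry.Motives
open Literature.AlgebraicGeometry.HodgeTheory
open Literature.AlgebraicTopology.SingularHomology

/-! ### On-path lemmas (R7, R6 are instances of the summit) -/

/-- ON-PATH (R7): `HodgeConjecture →` HC for every complex abelian variety of dimension `≤ 7`. -/
theorem hodgeConjectureFor_dim_le_seven_of_hodgeConjecture (h : _root_.HodgeConjecture) :
    ∀ A : AbelianVariety ℂ, A.dim ≤ 7 → IsSmoothProjective A.dim A.X → HodgeConjectureFor A.dim A.X :=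
  fun _ _ hX ↦ h hX

/-- ON-PATH (R6): `HodgeConjecture →` HC for every complex abelian sixfold. -/
theorem hodgeConjectureFor_sixfolds_of_hodgeConjecture (h : _root_.HodgeConjecture) :
    ∀ A : AbelianVariety ℂ, A.dim = 6 → IsSmoothProjective A.dim A.X → HodgeConjectureFor A.dim A.X :=
  fun _ _ hX ↦ h hX

/-- DOWN (R7 → R6): a sixfold has dimension `≤ 7`. -/
theorem hodgeConjectureFor_sixfolds_of_dim_le_seven
    (h : ∀ A : AbelianVariety ℂ, A.dim ≤ 7 → IsSmoothProjective A.dim A.X → HodgeConjectureFor A.dim A.X) :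
    ∀ A : AbelianVariety ℂ, A.dim = 6 → IsSmoothProjective A.dim A.X → HodgeConjectureFor A.dim A.X :=
  fun A hA hX ↦ h A (by omega) hX

/-! ### R6 → R1 → R1′ -/

/-- DOWN (R6 → R1): HC for all abelian sixfolds gives the shared crux `WeilSixfolds` (stmt-HodgeConjecture-2524):
the Weil class is a rational `(3,3)`-class on a smooth projective sixfold, so `HodgeConjectureFor 6 A.X` (its
cycle conjunct at `p = 3`) makes it algebraic; the eigen-splitting hypothesis is not even used. -/
theorem weilSixfolds_of_hodgeConjectureFor_sixfolds
    (h : ∀ A : AbelianVariety ℂ, A.dim = 6 → IsSmoothProjective A.dim A.X → HodgeConjectureFor A.dim A.X) :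
    Theses.SevenfoldWeilCensus.WeilSixfolds := by
  intro d _ A φ hA hsp _ c hc hct _
  have hA6 : A.dim = 6 := by omega
  have hsp' : IsSmoothProjective A.dim A.X := by rw [hA6]; exact hsp
  obtain ⟨-, H⟩ := h A hA6 hsp'
  have hct' : IsOfHodgeType A.dim A.X (2 * 3) 3 3 c := by rw [hA6]; exact hct
  exact H 3 c hc hct'

/-- DOWN (R6 → R1′ `NonsplitSixfolds`), through `nonsplitSixfolds_of_weilSixfolds`. -/
theorem nonsplitSixfolds_of_hodgeConjectureFor_sixfolds
    (h : ∀ A : AbelianVariety ℂ, A.dim = 6 → IsSmoothProjective A.dim A.X → HodgeConjectureFor A.dim A.X) :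
    NonsplitSixfolds :=
  nonsplitSixfolds_of_weilSixfolds (weilSixfolds_of_hodgeConjectureFor_sixfolds h)

/-! ### The reduction: census ∧ R1 ∧ floor → R7 → R6 (BY NAME) -/

/-- UP: the SEVENFOLD REDUCTION of route `SevenfoldWeilCensus` (assembly item stmt-HodgeConjecture-18724, proved as
`Theorems.sevenfoldWeilCensus_assembly_proof`) read at its unfolded type: the census cruxes (codimension 2:
stmt-18721; codimension 3: stmt-18720), rung R1 and the dim `≤ 5` floor give HC for every complex abelian variety
of dimension `≤ 7`. Conditional on its four hypotheses, which it names. -/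
theorem hodgeConjectureFor_dim_le_seven_of_census
    (h₃ : Theses.SevenfoldWeilCensus.CodimTwoFromLowerDim)
    (h₂ : Theses.SevenfoldWeilCensus.CodimThreeWeilGeneration)
    (h₄ : Theses.SevenfoldWeilCensus.WeilSixfolds)
    (h₅ : Theses.SevenfoldWeilCensus.HodgeAbelianDimLeFive) :
    ∀ A : AbelianVariety ℂ, A.dim ≤ 7 → IsSmoothProjective A.dim A.X → HodgeConjectureFor A.dim A.X :=
  fun A hA hX ↦ Theorems.sevenfoldWeilCensus_assembly_proof h₃ h₂ h₄ h₅ A hA hX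

/-- UP, restricted to sixfolds: "HC for ALL complex abelian sixfolds" from the two census cruxes, R1 and the floor. -/
theorem hodgeConjectureFor_sixfolds_of_census
    (h₃ : Theses.SevenfoldWeilCensus.CodimTwoFromLowerDim)
    (h₂ : Theses.SevenfoldWeilCensus.CodimThreeWeilGeneration)
    (h₄ : Theses.SevenfoldWeilCensus.WeilSixfolds)
    (h₅ : Theses.SevenfoldWeilCensus.HodgeAbelianDimLeFive) :
    ∀ A : AbelianVariety ℂ, A.dim = 6 → IsSmoothProjective A.dim A.X → HodgeConjectureFor A.dim A.X :=
  hodgeConjectureFor_sixfolds_of_dim_le_seven (hodgeConjectureFor_dim_le_seven_of_census h₃ h₂ h₄ h₅)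

/-- UP with R1 and the floor both read off R∞ (`WeilClassesImaginaryQuadratic`): R∞ ∧ census ⇒ R7, CONDITIONAL on
the Moonen–Zarhin named reduction fact `MoonenZarhin1999_hodgeClasses_abelian_dim_le_five_of_weilClassesFourfolds`
(hypothesis `hMZ`; its combination step is proved in `AbelianLowDimensionWeilReductionProofs`). -/
theorem hodgeConjectureFor_dim_le_seven_of_census_of_weilClassesImaginaryQuadratic_of_moonenZarhin
    (hMZ : MoonenZarhin1999_hodgeClasses_abelian_dim_le_five_of_weilClassesFourfolds)
    (h₃ : Theses.SevenfoldWeilCensus.CodimTwoFromLowerDim)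
    (h₂ : Theses.SevenfoldWeilCensus.CodimThreeWeilGeneration)
    (h : WeilClassesImaginaryQuadratic) :
    ∀ A : AbelianVariety ℂ, A.dim ≤ 7 → IsSmoothProjective A.dim A.X → HodgeConjectureFor A.dim A.X :=
  hodgeConjectureFor_dim_le_seven_of_census h₃ h₂ (weilSixfolds_of_weilClassesImaginaryQuadratic h)
    (floorDimLeFive_of_weilClassesImaginaryQuadratic_of_moonenZarhin hMZ h)

end Summit.HodgeConjecture.HodgeConjecture.WeilTypeLadder

end
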